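import Literature.Computability.Cryptography.RegevSamplerCnotLayer
import Literature.Computability.Cryptography.RegevSamplerBlocksStd
import Literature.Computability.Cryptography.RegevSamplerSrcStd
import Literature.Computability.QuantumComplexity.GRDataPar
import HarnessLib

/-!
# Regev 2009, Lemma 3.14 in machine form: the gates of the data-free erase layer on the standard layout

Topic `Computability/Cryptography` (family `pqc`), grouping namespace `Regev2009.SamplerRegs`; sequel of
`RegevSamplerCnotLayer.lean` (`cnotLayer σ T`: one `CNOT` per target, compiled), `GRDataPar.lean`
(`GRData.parList E` the parameter wires of all blocks, `GRData.parSrc E src` their sources), `RegevSamplerBlocksStd.lean`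
(`stdEmb`: the standard block embedding — point wires on the point zone, every other block wire `q` of block `i` on the
work wire `base + i·B + q`) and `RegevSamplerSrcStd.lean` (`srcU`: the sources, the input-zone positions `oU + p₀ + t`).

For the UNIFORMITY of the inner machine family (its description must be printed in polynomial time) the erase layer
of `machineCircPar` has to be known as an explicit list of gates with affine wire indices. This file records it:

* `cnotLayer_gates` — off the diagonal (`σ t ≠ t` on `T`) the layer is the list of the gates `CNOT(σ t, t)`, `t ∈ T`;
* `val_stdEmb_pw`, `val_srcU` — the target of parameter bit `t` of block `i` is the wire `base + (i·B + (ℓ + t))`, the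
  source the wire `loc (n·ℓ + (p₀ + t))` (`= n·ℓ + p₀ + t` on the standard layouts, whose `loc` is the identity);
* `eraseGate`, **`cnotLayer_par_gates`** — the erase layer of the standard data-free machine is the double loop
  `for i < n, for t < np: CNOT(srcU t, stdEmb i (pw t))`.

Everything is proved; no named fact is introduced.
HONEST FRAMING: kernel-checked lemmas of a KNOWN reduction (Regev 2009) — not summit progress.

## References

* O. Regev, *On lattices, learning with errors, random linear codes, and cryptography*, J. ACM 56 (2009), art. 34:
  Lemma 3.14 (proof: the registers; uncomputation) [Regev2009].
* M. A. Nielsen, I. L. Chuang, *Quantum Computation and Quantum Information*, CUP 2010, §3.2.5, §4.3, §4.5 [NielsenChuang2010].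
* S. Arora, B. Barak, *Computational Complexity: A Modern Approach*, CUP 2009, §6.2 (uniformly generated circuits) [AroraBarak2009].
-/

noncomputable section

namespace Literature.Computability.Cryptography

namespace Regev2009

namespace SamplerRegs

open Literature.Algebra.EuclideanLattices Literature.Algebra.EuclideanLattices.Regev2009 Literature.Computability.QuantumComplexity
  SamplerClassical SamplerClassical.Layout

/-! ### The gates of a `CNOT` layer -/

section Gates

variable {W : ℕ}

/-- Off the diagonal `cnotOp s t` compiles to the single gate `CNOT(s, t)`. [cite: NielsenChuang2010, §4.3] -/
theorem compile_cnotOp {s t : Fin W} (h : s ≠ t) : (cnotOp s t).compile = [cnotOn s t h] := by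
  unfold cnotOp; rw [dif_neg h]; rfl

/-- **The gates of the `CNOT` layer**: the compiled operations, target by target, in the order of `T`.
[cite: NielsenChuang2010, §3.2.5, §4.3] -/
theorem cnotLayer_gates (σ : Fin W → Fin W) (T : List (Fin W)) :
    (cnotLayer σ T).gates = T.flatMap fun t => (cnotOp (σ t) t).compile := by
  induction T with
  | nil => rfl
  | cons t T ih =>
    simp only [cnotLayer, List.map_cons, revCompile_cons, List.flatMap_cons] at ih ⊢
    rw [ih]

/-- Off the diagonal the layer has one gate per target. [folklore] -/
theorem length_cnotLayer_gates (σ : Fin W → Fin W) (T : List (Fin W)) (hσ : ∀ t ∈ T, σ t ≠ t) :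
    (cnotLayer σ T).gates.length = T.length := by
  induction T with
  | nil => rfl
  | cons t T ih =>
    rw [cnotLayer_gates, List.flatMap_cons, List.length_append, compile_cnotOp (hσ t List.mem_cons_self), List.length_singleton,
      ← cnotLayer_gates, ih (fun u hu => hσ u (List.mem_cons_of_mem t hu)), List.length_cons, Nat.add_comm]

end Gates

/-! ### The wires of the erase layer on the standard layout -/

section Std

variable {W : ℕ} (I : LatticeInstance) {Λ : Layout W I.n} (hΛ : Λ.OK)

/-- **The target wires**: parameter bit `t` of block `i` sits on the work wire `base + (i·B + (ℓ + t))`. [folklore] -/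
theorem val_stdEmb_pw {np wlen kk : ℕ} (hWE : Λ.base + I.n * GRData.B Λ.ℓ np wlen kk ≤ W) (i : Fin I.n) (t : Fin np) :
    (stdEmb I hΛ hWE i (GRData.pw Λ.ℓ np wlen kk t) : ℕ) = Λ.base + ((i : ℕ) * GRData.B Λ.ℓ np wlen kk + (Λ.ℓ + t)) := by
  rw [stdEmb_apply, stdEmbFun_val_of_le I _ i _ (by rw [GRData.pw_val]; omega), GRData.pw_val]

include hΛ in
/-- **The source wires**: source `t` is the zone wire `loc (oU + (p₀ + t))`. [folklore] -/
theorem val_srcU {p₀ np : ℕ} (hp : p₀ + np ≤ Λ.L) (t : Fin np) :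
    (srcU I Λ p₀ t : ℕ) = Λ.loc (I.n * Λ.ℓ + (p₀ + t)) := by
  have hT := Λ.T_eq
  obtain ⟨hU, -, -, -, -⟩ := offs_eq I Λ
  rw [srcU, fin_val hΛ (by have := t.2; omega), hU]

include hΛ in
/-- A source is not its target (the source is a zone wire, the target a work wire). [folklore] -/
theorem srcU_ne_stdEmb_pw {np wlen kk : ℕ} (hWE : Λ.base + I.n * GRData.B Λ.ℓ np wlen kk ≤ W) {p₀ : ℕ} (hp : p₀ + np ≤ Λ.L)
    (i : Fin I.n) (t : Fin np) : srcU I Λ p₀ t ≠ stdEmb I hΛ hWE i (GRData.pw Λ.ℓ np wlen kk t) := by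
  intro h
  have h1 := congrArg Fin.val h
  rw [val_stdEmb_pw] at h1
  have hT := Λ.T_eq
  obtain ⟨hU, -, -, -, -⟩ := offs_eq I Λ
  have h2 : (srcU I Λ p₀ t : ℕ) < Λ.base := fin_lt_base hΛ (by have := t.2; omega)
  omega

/-- **The erase gate** of parameter bit `t` of block `i`: `CNOT(source t, target (i, t))`.
[cite: Regev2009, Lemma 3.14 (proof: uncomputation)] [cite: NielsenChuang2010, §3.2.5] -/
def eraseGate {np wlen kk : ℕ} (hWE : Λ.base + I.n * GRData.B Λ.ℓ np wlen kk ≤ W) {p₀ : ℕ} (hp : p₀ + np ≤ Λ.L)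
    (i : Fin I.n) (t : Fin np) : QGate cliffordT W :=
  cnotOn (srcU I Λ p₀ t) (stdEmb I hΛ hWE i (GRData.pw Λ.ℓ np wlen kk t)) (srcU_ne_stdEmb_pw I hΛ hWE hp i t)

/-- **The gates of the erase layer of the standard data-free machine**: the double loop over blocks `i < n` and
parameter bits `t < np` of `CNOT(srcU t, stdEmb i (pw t))` — an explicit list with affine wire indices
(`val_srcU`, `val_stdEmb_pw`), as needed to print the layer's description with two counters.
[cite: Regev2009, Lemma 3.14 (proof: uncomputation)] [cite: AroraBarak2009, §6.2] -/
theorem cnotLayer_par_gates {np wlen kk : ℕ} (hWE : Λ.base + I.n * GRData.B Λ.ℓ np wlen kk ≤ W) {p₀ : ℕ} (hp : p₀ + np ≤ Λ.L)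
    (hE : BlockDisjoint (stdEmb I hΛ hWE)) :
    (cnotLayer (GRData.parSrc (stdEmb I hΛ hWE) (srcU I Λ p₀)) (GRData.parList (stdEmb I hΛ hWE))).gates =
      (List.finRange I.n).flatMap fun i => (List.finRange np).map fun t => eraseGate I hΛ hWE hp i t := by
  rw [cnotLayer_gates, GRData.parList, List.flatMap_assoc]
  congr 1
  funext i
  rw [List.flatMap_map, List.map_eq_flatMap]
  congr 1
  funext t
  rw [GRData.parSrc_apply hE, compile_cnotOp (srcU_ne_stdEmb_pw I hΛ hWE hp i t)]
  rfl

/-- The erase layer has `n · np` gates. [folklore] -/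
theorem length_cnotLayer_par_gates {np wlen kk : ℕ} (hWE : Λ.base + I.n * GRData.B Λ.ℓ np wlen kk ≤ W) {p₀ : ℕ}
    (hp : p₀ + np ≤ Λ.L) (hE : BlockDisjoint (stdEmb I hΛ hWE)) :
    (cnotLayer (GRData.parSrc (stdEmb I hΛ hWE) (srcU I Λ p₀)) (GRData.parList (stdEmb I hΛ hWE))).gates.length = I.n * np := by
  rw [cnotLayer_par_gates I hΛ hWE hp hE, List.length_flatMap]
  simp [List.map_const', List.sum_replicate]

end Std

end SamplerRegs

end Regev2009

end Literature.Computability.Cryptography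

end
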